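import Mathlib
import Summits.PneNP.PneNP.Theorems.Nc03AvoidResidualCoreReductionPack

/-!
# Route Nc03AvoidResidualCore, item `ResidualCoreReduction` — the one-flip lemma

Helper file for `stmt-PneNP-20227` (sequel of `…ReductionPack`; cell pnp-ideate). The dimension
trick behind the existence of `MAJ`/`MUX` certificates (ROUND-3 Addendum A of the cell record,
generalised): for an even-degree edge set `P` of a bipartite multigraph and ANY subspace `U` of
`𝔽₂^ι` with `dim U + |W| < |P|`, the indicator vectors of the fundamental cycles of `P` (one per
non-forest edge, each with a private coordinate) are linearly independent, so one of them, `χ_Z`,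
lies outside `U`; packing `P \ Z` and colouring `Z` by its alternating pattern or by the complement
gives two patterns `y₀, y₁`, both balanced on `P` and supported in `P`, whose indicator vectors
differ by `χ_Z ∉ U` — so at least one of them lies outside any given coset of `U` (`exists_flip`).
-/

set_option linter.dupNamespace false -- `Summit.PneNP.PneNP.…`: summit = sub-problem name (D-0017 single-conjunct layout)

namespace Summit.PneNP.PneNP.Theorems.Nc03Reduction

open Finset

/-- The indicator vector over `𝔽₂` of a finite set. -/
def chiS {ι : Type*} [DecidableEq ι] (S : Finset ι) : ι → ZMod 2 := fun j => if j ∈ S then 1 else 0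

/-- The indicator vector over `𝔽₂` of a Boolean pattern. -/
def chiP {ι : Type*} (y : ι → Bool) : ι → ZMod 2 := fun j => if y j = true then 1 else 0

/-- Evaluating the indicator vector of a set. -/
theorem chiS_apply {ι : Type*} [DecidableEq ι] (S : Finset ι) (j : ι) :
    chiS S j = if j ∈ S then 1 else 0 := rfl

/-- Evaluating the indicator vector of a pattern. -/
theorem chiP_apply {ι : Type*} (y : ι → Bool) (j : ι) : chiP y j = if y j = true then 1 else 0 := rfl

namespace Bip

variable {ι W : Type*} (G : Bip ι W) [LinearOrder W] [Fintype W] [LinearOrder ι] [Inhabited ι]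

noncomputable section
open Classical

omit [Fintype W] [LinearOrder ι] [Inhabited ι] in
/-- Transport of balance along an equality of edge sets. -/
theorem bal_of_eq {S S' : Finset ι} {y : ι → Bool} (h : S = S') (hS : G.Bal S y) : G.Bal S' y := by
  subst h; exact hS

/-- The candidate patterns of the flip construction on `P` at the edge `e`: the alternating pattern
of the fundamental cycle of `e` (complemented if `b`), extended by the packing pattern of the rest. -/
def flipCol (P : Finset ι) (e : ι) (b : Bool) (j : ι) : Bool :=
  if j ∈ G.fcycle P e then xor (G.fcol P e j) b else G.packCol (P \ G.fcycle P e) j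

/-- **The candidate patterns are balanced** (for an even-degree `P` and a non-forest edge `e`). -/
theorem bal_flipCol (P : Finset ι)
    (hA : ∀ a, Even (P.filter fun j => G.eA j = a).card)
    (hB : ∀ b, Even (P.filter fun j => G.eB j = b).card)
    {e : ι} (heP : e ∈ P) (heT : e ∉ G.forest P) (b : Bool) : G.Bal P (G.flipCol P e b) := by
  set Z := G.fcycle P e with hZ
  have hZP : Z ⊆ P := G.fcycle_subset heP
  have hbalZ : G.Bal Z (G.fcol P e) := G.bal_fcycle heP heT
  set Q := P \ Z with hQ
  have hQA : ∀ a, Even (Q.filter fun j => G.eA j = a).card := by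
    intro a
    have h1 := card_filter_sdiff hZP (fun j => G.eA j = a)
    have h3 := hA a
    rw [← h1] at h3
    exact (Nat.even_add.1 h3).2 (Bal.even_degA G hbalZ a)
  have hQB : ∀ b, Even (Q.filter fun j => G.eB j = b).card := by
    intro b
    have h1 := card_filter_sdiff hZP (fun j => G.eB j = b)
    have h3 := hB b
    rw [← h1] at h3
    exact (Nat.even_add.1 h3).2 (Bal.even_degB G hbalZ b)
  have hQfull := G.packUnion_eq_of_even Q hQA hQB
  have hbalQ : G.Bal Q (G.packCol Q) := by
    have := G.bal_packUnion Q; rwa [hQfull] at this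
  have hdisj : Disjoint Z Q := Finset.disjoint_sdiff
  have hPZQ : P = Z ∪ Q := by rw [hQ, Finset.union_sdiff_of_subset hZP]
  have hbalZ' : G.Bal Z (fun j => xor (G.fcol P e j) b) := by
    cases b
    · exact Bal.congr G hbalZ fun j _ => by simp
    · exact Bal.congr G (Bal.not G hbalZ) fun j _ => by simp
  have hb1 : G.Bal Z (G.flipCol P e b) :=
    Bal.congr G hbalZ' fun j hj => by unfold flipCol; rw [if_pos hj]
  have hb2 : G.Bal Q (G.flipCol P e b) :=
    Bal.congr G hbalQ fun j hj => by unfold flipCol; rw [if_neg (Finset.disjoint_right.1 hdisj hj)]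
  have hgoal : G.Bal (Z ∪ Q) (G.flipCol P e b) := by convert Bal.union G hb1 hb2 hdisj using 3
  exact G.bal_of_eq hPZQ.symm hgoal

/-- The candidate patterns are supported in `P`. -/
theorem mem_of_flipCol {P : Finset ι} {e : ι} (heP : e ∈ P) {b : Bool} {j : ι}
    (h : G.flipCol P e b j = true) : j ∈ P := by
  unfold flipCol at h
  by_cases hjZ : j ∈ G.fcycle P e
  · exact G.fcycle_subset heP hjZ
  · rw [if_neg hjZ] at h
    exact Finset.sdiff_subset ((G.packUnion_subset _) (G.mem_packUnion_of_packCol h))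

/-- The two candidate patterns at `e` differ exactly on the fundamental cycle of `e`. -/
theorem chiP_flipCol (P : Finset ι) (e : ι) :
    chiP (G.flipCol P e false) + chiP (G.flipCol P e true) = chiS (G.fcycle P e) := by
  funext j
  simp only [Pi.add_apply, chiP_apply, chiS_apply, flipCol]
  by_cases hjZ : j ∈ G.fcycle P e
  · simp only [if_pos hjZ, Bool.xor_false, Bool.xor_true]
    cases G.fcol P e j <;> decide
  · simp only [if_neg hjZ]
    cases G.packCol (P \ G.fcycle P e) j <;> decide

/-- **Fundamental cycles are linearly independent**: each has a private coordinate, its own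
non-forest edge. -/
theorem linearIndependent_fcycle (P : Finset ι) :
    LinearIndependent (ZMod 2) (fun e : ↥(P \ G.forest P) => chiS (G.fcycle P (e : ι))) := by
  rw [Fintype.linearIndependent_iff]
  intro c hc e'
  obtain ⟨he'P, he'T⟩ := Finset.mem_sdiff.1 e'.2
  have h := congrFun hc (e' : ι)
  simp only [Finset.sum_apply, Pi.smul_apply, smul_eq_mul, chiS_apply, Pi.zero_apply] at h
  rw [Finset.sum_eq_single e'] at h
  · rw [if_pos (G.self_mem_fcycle he'P), mul_one] at h
    exact h
  · intro e _ hne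
    obtain ⟨heP, -⟩ := Finset.mem_sdiff.1 e.2
    rw [if_neg, mul_zero]
    intro hmem
    by_cases heq : (e' : ι) = (e : ι)
    · exact hne (Subtype.ext heq.symm)
    · exact he'T (G.mem_forest_of_mem_fcycle heP hmem heq)
  · intro h; exact absurd (Finset.mem_univ _) h

variable [Fintype ι]

/-- Some fundamental cycle escapes any subspace of small dimension. -/
theorem exists_fcycle_not_mem (P : Finset ι) (U : Submodule (ZMod 2) (ι → ZMod 2))
    (hU : Module.finrank (ZMod 2) U < (P \ G.forest P).card) :
    ∃ e ∈ P \ G.forest P, chiS (G.fcycle P e) ∉ U := by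
  by_contra hno
  push Not at hno
  have hli := G.linearIndependent_fcycle P
  have h1 : Module.finrank (ZMod 2) (Submodule.span (ZMod 2)
      (Set.range fun e : ↥(P \ G.forest P) => chiS (G.fcycle P (e : ι)))) = (P \ G.forest P).card := by
    rw [finrank_span_eq_card hli, Fintype.card_coe]
  have h2 : Submodule.span (ZMod 2) (Set.range fun e : ↥(P \ G.forest P) => chiS (G.fcycle P (e : ι))) ≤ U :=
    Submodule.span_le.2 (by rintro _ ⟨e, rfl⟩; exact hno e e.2)
  have h3 := Submodule.finrank_mono h2
  omega

/-- **The one-flip lemma.** For an even-degree edge set `P` and a subspace `U` of `𝔽₂^ι` with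
`dim U + |W| < |P|`: some non-forest edge `e` of `P` whose two candidate patterns have indicators
NOT both in any one coset of `U` (their difference `χ_{Z(e)}` lies outside `U`). -/
theorem exists_flip (P : Finset ι) (U : Submodule (ZMod 2) (ι → ZMod 2))
    (hU : Module.finrank (ZMod 2) U + Fintype.card W < P.card) :
    ∃ e ∈ P, e ∉ G.forest P ∧ chiS (G.fcycle P e) ∉ U := by
  have hcard : Module.finrank (ZMod 2) U < (P \ G.forest P).card := by
    have h1 := Finset.card_sdiff_add_card_eq_card (G.forest_subset P)
    have h2 := G.card_forest_le P
    omega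
  obtain ⟨e, he, heU⟩ := G.exists_fcycle_not_mem P U hcard
  exact ⟨e, (Finset.mem_sdiff.1 he).1, (Finset.mem_sdiff.1 he).2, heU⟩

/-- Coset form of the one-flip lemma: if `v + χ(y_false) ∈ U` and `v + χ(y_true) ∈ U` then
`χ_Z ∈ U`; so for the edge of `exists_flip` one candidate has `v + χ ∉ U`. -/
theorem exists_flipCol_not_mem (P : Finset ι) (U : Submodule (ZMod 2) (ι → ZMod 2))
    (hU : Module.finrank (ZMod 2) U + Fintype.card W < P.card) (v : ι → ZMod 2) :
    ∃ e ∈ P, e ∉ G.forest P ∧ ∃ b : Bool, v + chiP (G.flipCol P e b) ∉ U := by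
  obtain ⟨e, heP, heT, heU⟩ := G.exists_flip P U hU
  refine ⟨e, heP, heT, ?_⟩
  by_contra hno
  push Not at hno
  have h0 := hno false
  have h1 := hno true
  have hsub := U.sub_mem h1 h0
  have e1 : v + chiP (G.flipCol P e true) - (v + chiP (G.flipCol P e false)) = chiS (G.fcycle P e) := by
    rw [← G.chiP_flipCol P e]
    funext j
    simp only [Pi.sub_apply, Pi.add_apply]
    generalize v j = a
    generalize chiP (G.flipCol P e true) j = p
    generalize chiP (G.flipCol P e false) j = q
    revert a p q; decide
  rw [e1] at hsub
  exact heU hsub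

end

end Bip

end Summit.PneNP.PneNP.Theorems.Nc03Reduction
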